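import Summits.ResolutionOfSingularities.ResolutionOfSingularities.Theorems.EquisingularLiftEquisingularLiftNatTowerBFourRoundOfFact
import Summits.ResolutionOfSingularities.ResolutionOfSingularities.Theorems.EquisingularLiftEquisingularLiftNatTowerEmbRoundOfFactAny
import Summits.ResolutionOfSingularities.ResolutionOfSingularities.Theorems.EquisingularLiftEquisingularLiftNatNodalHostedRoundOfCurveLift
import HarnessLib

/-!
# [OURS · L1 W4.5(b) · EL♮(3) · T23-A‴ engine, LETTER-AGNOSTIC] THE HOSTED ROUND ON `Tower.InvB₄` FROM AN ABSTRACT LIFT SUPPLIER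
# `Tower.hCentre_of_liftSupplier` / ★★ `Tower.invB₄_liftRound_of_supplier` (= ✓ `Tower.hCentre_of_secLicence` / ✓ `Tower.invB₄_secRound_of_licence`,
# …NatTowerBFourSecRound, res-L1-w45b-stub-4 g15, with the three Σ-LETTERS (N1)/(L2)/(L3) replaced by ONE abstract letter predicate `L` and the
# Σ-licence by an abstract SUPPLIER `hSup`), and `Tower.liftSupplier_of_secLicence` (the Σ-licence IS such a supplier: D12 is an instance)

res-L1-w45b-nose-w1 g7 (WIDTH seat D-0157 DOOR 1; self-directed under desk R76c «free hand», toward desk RULING R77 (c)(ii) 2026-08-29T10:09:44Z «every dealt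
door is an INSTANCE of the ν-lift slot»; announced STATUS 10:13:57Z).  OURS; NOT a statement of any manuscript ([Hironaka2017] is a candidate under adjudication,
nothing of it is asserted); AI-written, weaker than expert review.  No `sorry`; standard axioms; DEF-FREE (`L` is a bound variable).  EL♮(3) is NOT proved here.

WHAT.  In ✓ `…NatTowerBFourSecRound` the downstairs admissibility letters of the Σ-section hosted round — (N1) finitely many non-regular points of `Z̃`,
(L2) «`𝓘⟨Z⟩ = 𝓘⟨H⟩ + (f)`, `f ∉ 𝓘⟨H⟩ + 𝔪²`», (L3) `DirStepUnobs` — are READ AT EXACTLY ONE PLACE: handed to the Σ-licence `hSL` inside `Tower.hCentre_of_secLicence`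
(tree :141 ← :252); the host-dimension clause (T-DIM), 2-frames, (c4), the core ✓ `Tower.invB₄_embRoundCore`, shadow transports, births and the side facts of
`K′` never look at them.  So the hosted-round tower step is ALREADY letter-agnostic, and this file states it so:
* `L : ∀ (G : Scheme) (H : Set G), IsClosed H → ∀ (Z : Set G), IsClosed Z → Prop` — ANY downstairs letter predicate on (host, centre);
* `hSup` — a LIFT SUPPLIER for `L` at `(O, k, θ)`: the Σ-licence's binder (res-L1-w45b-stub-2 0196e0c85d2c112d / a09075309559ce22) VERBATIM with its three
  letter antecedents (N1), (L2), (L3) replaced by the single antecedent `L G E hE Z hZ` (the curve clause and the host-dimension clause stay: the engine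
  supplies them from the model, they are not door letters);
* `Tower.hCentre_of_liftSupplier` = ✓ `hCentre_of_secLicence` with `hZfin hL2 hunobs ↦ hL`; `Tower.invB₄_liftRound_of_supplier` = ✓ `invB₄_secRound_of_licence`
  with the same swap — proofs byte-for-byte otherwise (credit: res-L1-w45b-stub-4 g15 / res-L1-w45b-stub-2 T23-A‴; res-L1-w45b-lead-1 (c4) brick);
* `Tower.liftSupplier_of_secLicence` — the Σ-licence is a lift supplier for `L := fun G H hH Z hZ => (N1) ∧ (L2) ∧ (L3)`, so D12's step is an instance (R77 (c)(ii)).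
USE.  Any future HOSTED-round door (D14 «hyperplane-hosted», D15 «ν-LIFT», …) whose upstairs supplier has the licence shape `… → L G E hE Z hZ → ∃ C, 𝓔 ≤ C ∧
IsRegular C.subscheme ∧ Flat (C.subschemeι ≫ σ ≫ q) ∧ C.comap j = 𝓘⟨Z⟩` gets its tail-closure case on `INV₁‴(FE)` by instantiating `L` — no new engine file.
(DIRECT rounds ν3ᵈ/ν3ᶜⁱ and the PΓ plane round are other lemma families.) [cite: GortzWedhorn2020, Prop. 13.91 and (13.19)] [cite: Liu2002, §8.1 and Thm. 8.1.19]
-/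

set_option linter.dupNamespace false -- mandated namespace `Summit.<Summit>.<Problem>` of this single-conjunct summit
set_option linter.overlappingInstances false -- signatures carry `[IsDomain O] [IsDiscreteValuationRing O]`

noncomputable section

open CategoryTheory CategoryTheory.Limits AlgebraicGeometry TopologicalSpace Topology IsLocalRing
open Literature.AlgebraicGeometry.Resolution
open AlgebraicGeometry.Scheme.IdealSheafData
open Summit.ResolutionOfSingularities.ResolutionOfSingularities.Theses.EquisingularLift.Split
open Summit.ResolutionOfSingularities.ResolutionOfSingularities.Cruxes.EquisingularLift.StrataSplit

namespace Summit.ResolutionOfSingularities.ResolutionOfSingularities.Cruxes.EquisingularLiftNat.Sections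

/-- ★ **THE CENTRE DATUM FROM AN ABSTRACT LIFT SUPPLIER** — input `hCentre` of ✓ `Tower.invB₄_embRoundCore` at «`V(𝓔)` is `O`-flat»: `𝒦₁ := C ⊇ 𝓔` of `hSup`
(fed the curve clause, the host-dimension clause by T-DIM, and the abstract letter `hL : L G E hE Z hZ`), 2-frames and (c4) as in ✓ `Tower.hCentre_of_secLicence`
(res-L1-w45b-stub-4), of which this is the copy with `hZfin hL2 hunobs ↦ hL`. [OURS · L1 W4.5b · T23-A‴ engine, letter-agnostic]; NOT a statement of the manuscript. -/
theorem Tower.hCentre_of_liftSupplier (O : Type) [CommRing O] [IsDomain O] [IsDiscreteValuationRing O] (k : Type) [Field k]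
    (θ : O →+* k) (hθ : Function.Surjective θ)
    (P : Scheme.{0}) [IsIntegral P] (q : P ⟶ Spec (.of O)) [IsProper q] [SmoothOfRelativeDimension 3 q] (Y : Set P)
    (_hYsp : Y ⊆ q ⁻¹' {IsLocalRing.closedPoint O}) (hYirr : IsIrreducible Y) (hYcl : IsClosed Y)
    (hPnoeth : IsLocallyNoetherian P) (hPreg : Scheme.IsRegular P)
    (Ch : ∀ X' : Scheme.{0}, (X' ⟶ P) → Set X' → Prop)
    (_hChStep : ∀ (X' X'' : Scheme.{0}) (σ' : X' ⟶ P) (S' : Set X') (C : X'.IdealSheafData) (τ : X'' ⟶ X'),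
      Ch X' σ' S' → IsBlowup τ C → Scheme.IsRegular C.subscheme → Flat (C.subschemeι ≫ σ' ≫ q) →
      σ' '' (C.support : Set X') ⊆ {y | ¬ IsGenericPoint y Y} → (C.support : Set X') ∩ (σ' ≫ q) ⁻¹' {IsLocalRing.closedPoint O} ⊆ S' →
      Ch X'' (τ ≫ σ') (closure (τ ⁻¹' (S' \ (C.support : Set X')))))
    (hChSplit : ∀ (X' : Scheme.{0}) (σ' : X' ⟶ P) (S' : Set X'), Ch X' σ' S' → Chain P Y X' σ' S')
    -- an ABSTRACT downstairs letter predicate on (host `E`, centre `Z`) and a LIFT SUPPLIER for it AT `(O, k, θ)` (= the Σ-licence binder of res-L1-w45b-stub-2,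
    -- 0196e0c85d2c112d / a09075309559ce22, with its three letter antecedents (N1)/(L2)/(L3) replaced by `L G E hE Z hZ`)
    (L : ∀ (G : Scheme.{0}) (E : Set G), IsClosed E → ∀ (Z : Set G), IsClosed Z → Prop)
    (hSup :
      ∀ {P : Scheme.{0}} (X : Scheme.{0}) (σ : X ⟶ P) (q : P ⟶ Spec (.of O)) (𝓔 : X.IdealSheafData),
        IsIntegral X → IsLocallyNoetherian X → Scheme.IsRegular X → IsProper (σ ≫ q) →
        (∀ x : X, (stalkIdeal 𝓔 x).IsPrincipal) → 𝓔 ≠ ⊥ →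
        Scheme.IsRegular 𝓔.subscheme → Flat (𝓔.subschemeι ≫ σ ≫ q) → IsProper (𝓔.subschemeι ≫ σ ≫ q) →
        ∀ (G : Scheme.{0}) (j : G ⟶ X) (t : G ⟶ Spec (.of k)),
          IsPullback j t (σ ≫ q) (Spec.map (CommRingCat.ofHom θ)) →
          ∀ (E : Set G) (hE : IsClosed E), 𝓔.comap j = vanishingIdeal (⟨E, hE⟩ : Closeds G) →
          ∀ (Z : Set G) (hZ : IsClosed Z), Z ⊆ E →
            (∀ z : ↥(redSub G Z hZ), IsClosed ({z} : Set ↥(redSub G Z hZ)) →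
              ringKrullDim ((redSub G Z hZ).presheaf.stalk z) = ((1 : ℕ) : WithBot ℕ∞)) →
            (∀ (i : redSub G Z hZ ⟶ redSub G E hE), i ≫ redSubι G E hE = redSubι G Z hZ →
              ∀ z : ↥(redSub G Z hZ), IsClosed ({z} : Set ↥(redSub G Z hZ)) →
                ringKrullDim ((redSub G E hE).presheaf.stalk (i z)) = ((2 : ℕ) : WithBot ℕ∞)) →
            L G E hE Z hZ →
            ∃ C : X.IdealSheafData, 𝓔 ≤ C ∧ Scheme.IsRegular C.subscheme ∧ Flat (C.subschemeι ≫ σ ≫ q) ∧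
              C.comap j = vanishingIdeal (⟨Z, hZ⟩ : Closeds G))
    : ∀ {F₉ : Scheme.{0}} (Z₉ : Set F₉) (hZ₉ : IsClosed Z₉) {F₁₀ : Scheme.{0}} (υ' : F₁₀ ⟶ F₉)
    (G : Scheme.{0}) (γ : G ⟶ F₁₀) (T E : Set G) (hE : IsClosed E) (Z : Set G) (hZ : IsClosed Z),
    E ≠ Set.univ → Z ⊆ E → L G E hE Z hZ →
    (∀ z : ↥(redSub G Z hZ), IsClosed ({z} : Set ↥(redSub G Z hZ)) → ringKrullDim ((redSub G Z hZ).presheaf.stalk z) = ((1 : ℕ) : WithBot ℕ∞)) →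
    ∀ (X : Scheme.{0}) (σ : X ⟶ P) (S : Set X) (jG : G ⟶ X) (tG : G ⟶ Spec (.of k)) (𝓔 : X.IdealSheafData),
      Ch X σ S → IsIntegral X → IsLocallyNoetherian X → Scheme.IsRegular X → IsDominant (σ ≫ q) →
      IsPullback jG tG (σ ≫ q) (Spec.map (CommRingCat.ofHom θ)) → jG '' T = S →
      𝓔.comap jG = vanishingIdeal ⟨E, hE⟩ → (∀ z : X, (stalkIdeal 𝓔 z).IsPrincipal) → Scheme.IsRegular 𝓔.subscheme →
      σ '' (𝓔.support : Set X) ⊆ {p : P | ¬ IsGenericPoint p Y} →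
      (fun _ _ _ _ _ _ _ _ _ σ _ 𝓔 => Flat (𝓔.subschemeι ≫ σ ≫ q)) F₉ Z₉ hZ₉ F₁₀ υ' G γ E X σ jG 𝓔 →
      ∃ 𝒦₁ : X.IdealSheafData,
        (𝓔 ⊔ 𝒦₁).comap jG = vanishingIdeal ⟨Z, hZ⟩ ∧ Flat ((𝓔 ⊔ 𝒦₁).subschemeι ≫ σ ≫ q) ∧
        Scheme.IsRegular (𝓔 ⊔ 𝒦₁).subscheme ∧ IsEffectiveCartier (𝒦₁.comap 𝓔.subschemeι) ∧
        (∀ x ∈ (𝓔 ⊔ 𝒦₁).support, ∃ c : Fin 2 → X.presheaf.stalk x,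
          Ideal.span (Set.range c) = stalkIdeal (𝓔 ⊔ 𝒦₁) x ∧ IsQuasiRegular c) := by
  intro F₉ Z₉ hZ₉ F₁₀ υ' G γ T E hE Z hZ hEne hZE hL hZdim X σ S jG tG 𝓔 hCh hXint hXnoeth hXreg hdom hsq hTS he_i he_ii
    he_iii _ hFE
  haveI := hXint
  haveI := hXnoeth
  obtain ⟨-, -, hσ⟩ := chain_isRegular P Y X σ S (hChSplit _ _ _ hCh) hPnoeth hPreg
  haveI := hσ
  haveI : IsProper (σ ≫ q) := inferInstance
  have hflatE : Flat (𝓔.subschemeι ≫ σ ≫ q) := hFE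
  have hpropE : IsProper (𝓔.subschemeι ≫ σ ≫ q) := inferInstance
  -- `𝓔 ≠ ⊥` (its trace is `𝓘⟨E⟩` with `E ≠ G`) — read by the supplier and by (c4)
  have h𝓔0 : 𝓔 ≠ ⊥ := by
    intro h0
    apply hEne
    have h2 : (((vanishingIdeal ⟨E, hE⟩ : G.IdealSheafData)).support : Set G) = ((⊤ : Closeds G) : Set G) := by
      rw [← he_i, h0, Scheme.IdealSheafData.comap_bot, Scheme.IdealSheafData.support_bot]
    rwa [Scheme.IdealSheafData.coe_support_vanishingIdeal, Closeds.coe_top] at h2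
  -- the host is two-dimensional at the closed points of `Z̃` (T-DIM, ✓ `ringKrullDim_redSub_stalk_eq_two_of_letter`, this seat g14)
  obtain ⟨ξ, hξ⟩ := QuasiSober.sober hYirr hYcl
  haveI : Flat (𝓔.subschemeι ≫ σ ≫ q) := hflatE
  have hEdim : ∀ (i : redSub G Z hZ ⟶ redSub G E hE), i ≫ redSubι G E hE = redSubι G Z hZ →
      ∀ z : ↥(redSub G Z hZ), IsClosed ({z} : Set ↥(redSub G Z hZ)) →
        ringKrullDim ((redSub G E hE).presheaf.stalk (i z)) = ((2 : ℕ) : WithBot ℕ∞) := by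
    intro i hi z hz
    refine ringKrullDim_redSub_stalk_eq_two_of_letter O k θ hθ q hξ (hChSplit _ _ _ hCh) jG tG hsq 𝓔 he_ii h𝓔0 hE he_i (i z) ?_
    have hzF : IsClosed ({(redSubι G Z hZ) z} : Set G) := by
      have h1 := ((redSubι G Z hZ).isClosedEmbedding.isClosedMap) _ hz
      rwa [Set.image_singleton] at h1
    have h1 : ({i z} : Set ↥(redSub G E hE)) = (redSubι G E hE) ⁻¹' {(redSubι G Z hZ) z} := by
      ext s'
      simp only [Set.mem_singleton_iff, Set.mem_preimage]
      constructor
      · intro h; rw [h, ← Scheme.Hom.comp_apply, hi]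
      · intro h
        apply (redSubι G E hE).isClosedEmbedding.injective
        rw [h, ← Scheme.Hom.comp_apply, hi]
    rw [h1]
    exact hzF.preimage (redSubι G E hE).continuous
  obtain ⟨C, h𝓔C, hCreg, hCflat, hCtr⟩ :=
    hSup X σ q 𝓔 hXint hXnoeth hXreg inferInstance he_ii h𝓔0 he_iii hflatE hpropE G jG tG hsq E hE he_i Z hZ hZE hZdim hEdim hL
  have hfr : ∀ x ∈ C.support, ∃ c : Fin 2 → X.presheaf.stalk x, Ideal.span (Set.range c) = stalkIdeal C x ∧ IsQuasiRegular c :=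
    hFrame_of_ringKrullDim_redSub O k θ hθ P q Y hYirr hYcl hPnoeth hPreg Ch hChSplit T Z hZ hZdim X σ S jG tG C hCh hXint hXnoeth
      hXreg hdom hsq hTS hCtr hCflat hCreg
  have hsup : 𝓔 ⊔ C = C := sup_eq_right.mpr h𝓔C
  -- (c4) by res-L1-w45b-lead-1's brick: `𝓔` is Cartier (locally principal and non-zero: its trace is `𝓘⟨E⟩` with `E ≠ G`)
  have h𝓔cart : IsEffectiveCartier 𝓔 := isEffectiveCartier_of_isPrincipal_stalkIdeal_of_ne_bot he_ii h𝓔0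
  refine ⟨C, ?_, ?_, ?_, isEffectiveCartier_comap_subschemeι_of_frames hXreg 𝓔 C h𝓔C h𝓔cart he_iii hfr, ?_⟩
  · rw [hsup]; exact hCtr
  · rw [hsup]; exact hCflat
  · rw [hsup]; exact hCreg
  · rw [hsup]; exact hfr

section Fact

variable (O : Type) [CommRing O] [IsDomain O] [IsDiscreteValuationRing O] (k : Type) [Field k]
    (θ : O →+* k) (hθ : Function.Surjective θ)
    (P : Scheme.{0}) [IsIntegral P] (q : P ⟶ Spec (.of O)) [IsProper q] [SmoothOfRelativeDimension 3 q] (Y : Set P)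
    (hYsp : Y ⊆ q ⁻¹' {IsLocalRing.closedPoint O}) (hYirr : IsIrreducible Y) (hYcl : IsClosed Y)
    (hPnoeth : IsLocallyNoetherian P) (hPreg : Scheme.IsRegular P)
    (Ch : ∀ X' : Scheme.{0}, (X' ⟶ P) → Set X' → Prop)
    (hChStep : ∀ (X' X'' : Scheme.{0}) (σ' : X' ⟶ P) (S' : Set X') (C : X'.IdealSheafData) (τ : X'' ⟶ X'),
      Ch X' σ' S' → IsBlowup τ C → Scheme.IsRegular C.subscheme → Flat (C.subschemeι ≫ σ' ≫ q) →
      σ' '' (C.support : Set X') ⊆ {y | ¬ IsGenericPoint y Y} → (C.support : Set X') ∩ (σ' ≫ q) ⁻¹' {IsLocalRing.closedPoint O} ⊆ S' →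
      Ch X'' (τ ≫ σ') (closure (τ ⁻¹' (S' \ (C.support : Set X')))))
    (hChSplit : ∀ (X' : Scheme.{0}) (σ' : X' ⟶ P) (S' : Set X'), Ch X' σ' S' → Chain P Y X' σ' S')

include hθ hYsp hYirr hYcl hPnoeth hPreg hChStep hChSplit

set_option maxHeartbeats 800000 in
/-- ★★ **THE HOSTED ROUND ON `Tower.InvB₄` FROM AN ABSTRACT LIFT SUPPLIER (letter-agnostic tower step)** — ✓ `Tower.invB₄_secRound_of_licence`
(res-L1-w45b-stub-4 g15, D12; itself ✓ `Tower.invB₄_embRound_of_fact_anyPrime` re-licensed) VERBATIM with the three Σ-letters (N1)/(L2)/(L3) replaced by the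
single abstract letter `hL : L G H hH Z hZ` and the Σ-licence by the supplier `hSup` for `L`; the centre comes from `Tower.hCentre_of_liftSupplier`; host
`H = E` (shadow `K`) or `H ∈ Es` (shadow `∅`), both menus, side facts of `K′` — everything downstream of the centre untouched.
[OURS · L1 W4.5b · T23-A‴ engine, letter-agnostic; toward desk R77 (c)(ii)]; NOT a statement of the manuscript; EL♮(3) NOT proved. -/
theorem Tower.invB₄_liftRound_of_supplier
    (L : ∀ (G : Scheme.{0}) (E : Set G), IsClosed E → ∀ (Z : Set G), IsClosed Z → Prop)
    (hSup :
      ∀ {P : Scheme.{0}} (X : Scheme.{0}) (σ : X ⟶ P) (q : P ⟶ Spec (.of O)) (𝓔 : X.IdealSheafData),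
        IsIntegral X → IsLocallyNoetherian X → Scheme.IsRegular X → IsProper (σ ≫ q) →
        (∀ x : X, (stalkIdeal 𝓔 x).IsPrincipal) → 𝓔 ≠ ⊥ →
        Scheme.IsRegular 𝓔.subscheme → Flat (𝓔.subschemeι ≫ σ ≫ q) → IsProper (𝓔.subschemeι ≫ σ ≫ q) →
        ∀ (G : Scheme.{0}) (j : G ⟶ X) (t : G ⟶ Spec (.of k)),
          IsPullback j t (σ ≫ q) (Spec.map (CommRingCat.ofHom θ)) →
          ∀ (E : Set G) (hE : IsClosed E), 𝓔.comap j = vanishingIdeal (⟨E, hE⟩ : Closeds G) →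
          ∀ (Z : Set G) (hZ : IsClosed Z), Z ⊆ E →
            (∀ z : ↥(redSub G Z hZ), IsClosed ({z} : Set ↥(redSub G Z hZ)) →
              ringKrullDim ((redSub G Z hZ).presheaf.stalk z) = ((1 : ℕ) : WithBot ℕ∞)) →
            (∀ (i : redSub G Z hZ ⟶ redSub G E hE), i ≫ redSubι G E hE = redSubι G Z hZ →
              ∀ z : ↥(redSub G Z hZ), IsClosed ({z} : Set ↥(redSub G Z hZ)) →
                ringKrullDim ((redSub G E hE).presheaf.stalk (i z)) = ((2 : ℕ) : WithBot ℕ∞)) →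
            L G E hE Z hZ →
            ∃ C : X.IdealSheafData, 𝓔 ≤ C ∧ Scheme.IsRegular C.subscheme ∧ Flat (C.subschemeι ≫ σ ≫ q) ∧
              C.comap j = vanishingIdeal (⟨Z, hZ⟩ : Closeds G)) :
    ∀ {F₉ : Scheme.{0}} (Z₉ : Set F₉) (hZ₉ : IsClosed Z₉) {F₁₀ : Scheme.{0}} (υ' : F₁₀ ⟶ F₉)
    (G G' : Scheme.{0}) (γ : G ⟶ F₁₀) (T E : Set G) (Es Ns : List (Set G)) (K H KH : Set G) (hH : IsClosed H) (Z : Set G) (hZ : IsClosed Z)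
    (υ₂ : G' ⟶ G) (K' E' : Set G') (Es' Ns' : List (Set G')),
    (Tower.InvB₄ O k θ P q Y Ch (fun _ _ _ _ _ _ _ _ _ σ _ 𝓔 => Flat (𝓔.subschemeι ≫ σ ≫ q)) F₉ Z₉ hZ₉ F₁₀ υ' G γ T E Es Ns K ∧
      IsClosed K ∧ K ⊆ closure (K \ E) ∧ K ≠ Set.univ) →
    ((H = E ∧ KH = K) ∨ (H ∈ Es ∧ KH = ∅)) →
    Z ⊆ H ∩ T → Z.Nonempty → L G H hH Z hZ →
    (∀ z : ↥(redSub G Z hZ), IsClosed ({z} : Set ↥(redSub G Z hZ)) → ringKrullDim ((redSub G Z hZ).presheaf.stalk z) = ((1 : ℕ) : WithBot ℕ∞)) →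
    IsBlowup υ₂ (vanishingIdeal (⟨Z, hZ⟩ : Closeds G)) →
    (K' = ∅ ∨ (closure (Z \ closure KH) = Z ∧ K' = closure (υ₂ ⁻¹' (KH \ Z)))) →
    (E' = υ₂ ⁻¹' Z ∨ E' = closure (υ₂ ⁻¹' (H \ Z))) →
    (∀ F' ∈ Es', ∃ F ∈ E :: Es, RoundTransportOKPrime υ₂ Z hZ H F F') →
    (∀ F' ∈ Ns', ∃ F : Set G, (F ∈ Ns ∨ F ∈ E :: Es) ∧ F' = closure (υ₂ ⁻¹' (F \ Z))) →
    (Tower.InvB₄ O k θ P q Y Ch (fun _ _ _ _ _ _ _ _ _ σ _ 𝓔 => Flat (𝓔.subschemeι ≫ σ ≫ q)) F₉ Z₉ hZ₉ F₁₀ υ' G' (υ₂ ≫ γ) (closure (υ₂ ⁻¹' (T \ Z))) E' Es' Ns' K' ∧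
      IsClosed K' ∧ K' ⊆ closure (K' \ E') ∧ K' ≠ Set.univ) := by
  intro F₉ Z₉ hZ₉ F₁₀ υ' G G' γ T E Es Ns K H KH hH Z hZ υ₂ K' E' Es' Ns' hI hhost hZHT hZne hL hZdim hυ₂ hK' hE' hEs' hNs'
  obtain ⟨hinv, hKcl, hKE, hKne⟩ := hI
  obtain ⟨hυ', hZinf, hGint, hTcl, hTirr, hEcl, hTE, hEsB, hNsB, X, σ, S, jG, tG, hCh, hXint, hXnoeth, hXreg, hdom, hsq, hTS, hExc, hExcF⟩ := hinv
  haveI := hGint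
  haveI := hXint
  haveI := hXnoeth
  have hZH : Z ⊆ H := fun z hz => (hZHT hz).1
  have hZsupp : ((vanishingIdeal (⟨Z, hZ⟩ : Closeds G) : G.IdealSheafData).support : Set G) = Z :=
    Scheme.IdealSheafData.coe_support_vanishingIdeal _
  -- the candidates `E :: Es`, shadows forgotten
  have hCand : ∀ F ∈ E :: Es, ∃ hF : IsClosed F, ¬ T ⊆ F ∧
      Tower.Exc₄ O P q Y (fun _ _ _ _ _ _ _ _ _ σ _ 𝓔 => Flat (𝓔.subschemeι ≫ σ ≫ q)) Z₉ hZ₉ υ' G γ F hF ∅ X σ jG := by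
    intro F hF
    rcases List.mem_cons.mp hF with rfl | hF
    · exact ⟨hEcl, hTE, Tower.exc₄_forgetShadow O P q Y _ (hExc hEcl)⟩
    · exact ⟨(hEsB F hF).1, (hEsB F hF).2, hExcF F hF (hEsB F hF).1⟩
  -- the host's datum and bookkeeping
  have hhost' : ¬ T ⊆ H ∧ Tower.Exc₄ O P q Y (fun _ _ _ _ _ _ _ _ _ σ _ 𝓔 => Flat (𝓔.subschemeι ≫ σ ≫ q)) Z₉ hZ₉ υ' G γ H hH KH X σ jG ∧
      IsClosed KH ∧ KH ⊆ closure (KH \ H) ∧ KH ≠ Set.univ := by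
    rcases hhost with ⟨rfl, rfl⟩ | ⟨hmem, rfl⟩
    · exact ⟨hTE, hExc hH, hKcl, hKE, hKne⟩
    · refine ⟨(hEsB H hmem).2, hExcF H hmem hH, isClosed_empty, Set.empty_subset _, ?_⟩
      obtain ⟨z, _⟩ := hZne
      haveI : Nonempty G := ⟨z⟩
      exact Set.empty_ne_univ
  obtain ⟨hTH, hExcH, hKHcl, hKHE, hKHne⟩ := hhost'
  have hHne : H ≠ Set.univ := fun h => hTH (h ▸ Set.subset_univ _)
  have hTZ : ¬ T ⊆ Z := fun h => hTH (h.trans hZH)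
  -- the dischargers at `FE`
  have hC := Tower.hCentre_of_liftSupplier O k θ hθ P q Y hYsp hYirr hYcl hPnoeth hPreg Ch hChStep hChSplit L hSup Z₉ hZ₉ υ' G γ T H hH Z hZ hHne
    hZH hL hZdim
  have hS := Tower.hShadow_of_any O k θ hθ P q ‹IsProper q› Y hYirr hYcl hPnoeth hPreg Ch hChSplit ‹IsIntegral P› Z₉ hZ₉ υ' G G' γ T H KH hH Z hZ
    υ₂ hυ₂
  have hSo := Tower.hShadowOld_of_any O k θ hθ P q ‹IsProper q› Y hYirr hYcl hPnoeth hPreg Ch hChSplit ‹IsIntegral P› Z₉ hZ₉ υ' G G' γ T H KH hH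
    Z hZ υ₂ hυ₂
  have hBorn : ∀ (X : Scheme.{0}) (σ : X ⟶ P) (S : Set X) (jG : G ⟶ X) (tG : G ⟶ Spec (.of k)) (𝓔 𝒦₁ : X.IdealSheafData)
      (X'' : Scheme.{0}) (τ : X'' ⟶ X) (j₂ : G' ⟶ X'') (t₂ : G' ⟶ Spec (.of k)),
      Ch X σ S → IsIntegral X → IsLocallyNoetherian X → Scheme.IsRegular X → IsDominant (σ ≫ q) →
      IsPullback jG tG (σ ≫ q) (Spec.map (CommRingCat.ofHom θ)) → jG '' T = S →
      (𝓔 ⊔ 𝒦₁).comap jG = vanishingIdeal ⟨Z, hZ⟩ → Flat ((𝓔 ⊔ 𝒦₁).subschemeι ≫ σ ≫ q) → Scheme.IsRegular (𝓔 ⊔ 𝒦₁).subscheme →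
      Scheme.IsRegular 𝓔.subscheme → IsBlowup τ (𝓔 ⊔ 𝒦₁) → IsPullback j₂ t₂ ((τ ≫ σ) ≫ q) (Spec.map (CommRingCat.ofHom θ)) →
      j₂ ≫ τ = υ₂ ≫ jG →
      Flat ((((𝓔 ⊔ 𝒦₁).comap τ)).subschemeι ≫ (τ ≫ σ) ≫ q) := by
    intro X σ S jG tG 𝓔 𝒦₁ X'' τ j₂ t₂ _ _ hXnoeth hXreg _ _ _ _ hc2 hc3 _ hτ _ _
    haveI := hXnoeth
    rw [Category.assoc]
    exact flat_exceptional_of_isBlowup_regularCentre O X X'' (σ ≫ q) (𝓔 ⊔ 𝒦₁) hXreg hc3 hc2 τ hτ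
  have hIso : ∀ (G₀ G₀' : Scheme.{0}) (γ₀ : G₀ ⟶ F₁₀) (γ₀' : G₀' ⟶ F₁₀) (E₀ : Set G₀) (E₀' : Set G₀') (X₀ X₀'' : Scheme.{0})
      (σ₀ : X₀ ⟶ P) (j₀ : G₀ ⟶ X₀) (j₀' : G₀' ⟶ X₀'') (𝓔₀ : X₀.IdealSheafData) (𝓔₀' : X₀''.IdealSheafData) (τ₀ : X₀'' ⟶ X₀),
      (∃ e : 𝓔₀'.subscheme ≅ 𝓔₀.subscheme, e.hom ≫ 𝓔₀.subschemeι = 𝓔₀'.subschemeι ≫ τ₀) →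
      (fun _ _ _ _ _ _ _ _ _ σ _ 𝓔 => Flat (𝓔.subschemeι ≫ σ ≫ q)) F₉ Z₉ hZ₉ F₁₀ υ' G₀ γ₀ E₀ X₀ σ₀ j₀ 𝓔₀ →
      (fun _ _ _ _ _ _ _ _ _ σ _ 𝓔 => Flat (𝓔.subschemeι ≫ σ ≫ q)) F₉ Z₉ hZ₉ F₁₀ υ' G₀' γ₀' E₀' X₀'' (τ₀ ≫ σ₀) j₀' 𝓔₀' := by
    intro G₀ G₀' γ₀ γ₀' E₀ E₀' X₀ X₀'' σ₀ j₀ j₀' 𝓔₀ 𝓔₀' τ₀ he hflat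
    obtain ⟨e, he⟩ := he
    have hflat' : Flat (𝓔₀.subschemeι ≫ σ₀ ≫ q) := hflat
    have heq : 𝓔₀'.subschemeι ≫ (τ₀ ≫ σ₀) ≫ q = e.hom ≫ 𝓔₀.subschemeι ≫ σ₀ ≫ q := by
      rw [← Category.assoc e.hom, he]; simp only [Category.assoc]
    show Flat (𝓔₀'.subschemeι ≫ (τ₀ ≫ σ₀) ≫ q)
    rw [heq]
    infer_instance
  -- T23-A′: the strict-transform transport of the datum `FE` (res-L1-w45b-stub-2's T-STFLAT-GEN)
  have hRuledSt : ∀ (G₀ G₀' : Scheme.{0}) (γ₀ : G₀ ⟶ F₁₀) (γ₀' : G₀' ⟶ F₁₀) (E₀ : Set G₀) (E₀' : Set G₀') (X₀ X₀'' : Scheme.{0})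
      (σ₀ : X₀ ⟶ P) (j₀ : G₀ ⟶ X₀) (j₀' : G₀' ⟶ X₀'') (𝓔₀ C₀ : X₀.IdealSheafData) (τ₀ : X₀'' ⟶ X₀),
      IsBlowup τ₀ C₀ → IsLocallyNoetherian X₀ → IsLocallyNoetherian X₀'' →
      (fun _ _ _ _ _ _ _ _ _ σ _ 𝓔 => Flat (𝓔.subschemeι ≫ σ ≫ q)) F₉ Z₉ hZ₉ F₁₀ υ' G₀ γ₀ E₀ X₀ σ₀ j₀ 𝓔₀ →
      (fun _ _ _ _ _ _ _ _ _ σ _ 𝓔 => Flat (𝓔.subschemeι ≫ σ ≫ q)) F₉ Z₉ hZ₉ F₁₀ υ' G₀' γ₀' E₀' X₀'' (τ₀ ≫ σ₀) j₀'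
        (strictTransformIdeal τ₀ C₀ 𝓔₀) := by
    intro G₀ G₀' γ₀ γ₀' E₀ E₀' X₀ X₀'' σ₀ j₀ j₀' 𝓔₀ C₀ τ₀ hτ₀ hX₀ hX₀'' hflat
    haveI := hX₀
    haveI := hX₀''
    have hflat' : Flat (𝓔₀.subschemeι ≫ σ₀ ≫ q) := hflat
    show Flat ((strictTransformIdeal τ₀ C₀ 𝓔₀).subschemeι ≫ (τ₀ ≫ σ₀) ≫ q)
    exact flat_strictTransform_subschemeι_comp_stage O σ₀ q τ₀ C₀ hτ₀ 𝓔₀ hflat'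
  -- T23-A′: the third transport alternative = the stalkwise (T1) ∧ (T2) of `RoundTransportOKPrime`
  let X3 : Set G → Prop := fun F => ∃ hF : IsClosed F,
    (∀ g ∈ Z ∩ F, stalkIdeal (vanishingIdeal (⟨Z, hZ⟩ : Closeds G)) g ⊔ stalkIdeal (vanishingIdeal (⟨F, hF⟩ : Closeds G)) g =
        maximalIdeal (G.presheaf.stalk g)) ∧
      ∀ g ∈ Z ∩ F, stalkIdeal (vanishingIdeal (⟨Z, hZ⟩ : Closeds G)) g ≠ maximalIdeal (G.presheaf.stalk g)
  have hEs'' : ∀ F' ∈ Es', ∃ F ∈ E :: Es, (F = H ∨ Disjoint Z F ∨ X3 F) ∧ F' = closure (υ₂ ⁻¹' (F \ Z)) := by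
    intro F' hF'
    obtain ⟨F, hF, hok⟩ := hEs' F' hF'
    exact ⟨F, hF, hok⟩
  -- T23-A′ (A′-1): snc of a transversally crossed member with the centre (res-L1-w45b-lead-2 p608670)
  have hSNC : ∀ (C 𝓕 : X.IdealSheafData) (F : Set G) (hF : IsClosed F), X3 F → IsProper (σ ≫ q) →
      C.comap jG = vanishingIdeal ⟨Z, hZ⟩ → Flat (C.subschemeι ≫ σ ≫ q) → Scheme.IsRegular C.subscheme →
      𝓕.comap jG = vanishingIdeal ⟨F, hF⟩ → (∀ z : X, (stalkIdeal 𝓕 z).IsPrincipal) → Scheme.IsRegular 𝓕.subscheme →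
      σ '' (𝓕.support : Set X) ⊆ {p : P | ¬ IsGenericPoint p Y} →
      (fun _ _ _ _ _ _ _ _ _ σ _ 𝓔 => Flat (𝓔.subschemeι ≫ σ ≫ q)) F₉ Z₉ hZ₉ F₁₀ υ' G γ F X σ jG 𝓕 → ¬ T ⊆ F →
      HasSNCWith [𝓕] C := by
    intro C 𝓕 F hF hX3 hprop hC _ hCreg hF1 hF2 hF3 _ _ hTF
    obtain ⟨hF', hT1, hT2⟩ := hX3
    haveI := hprop
    have h𝓕0 : 𝓕 ≠ ⊥ := by
      rintro rfl
      apply hTF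
      have h1 : (vanishingIdeal (⟨F, hF⟩ : Closeds G) : G.IdealSheafData) = ⊥ := by
        rw [← hF1, Scheme.IdealSheafData.comap_bot]
      have h2 : ((vanishingIdeal (⟨F, hF⟩ : Closeds G) : G.IdealSheafData).support : Set G) = Set.univ := by
        rw [h1, Scheme.IdealSheafData.support_bot]; rfl
      rw [Scheme.IdealSheafData.coe_support_vanishingIdeal] at h2
      change F = Set.univ at h2
      rw [h2]; exact Set.subset_univ _
    exact hasSNCWith_member_centre_of_trace_transversal hXreg hsq hθ hC hCreg hF1 hF2 hF3 h𝓕0 hT1 hT2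
  -- T23-A′ (A′-3): the special-fibre trace of the strict transform (res-L1-w45b-stub-2, slim twin)
  have hTrace : ∀ (C 𝓕 : X.IdealSheafData) (F : Set G) (hF : IsClosed F) (X₂ : Scheme.{0}) (τ : X₂ ⟶ X) (j₂ : G' ⟶ X₂)
      (t₂ : G' ⟶ Spec (.of k)), X3 F → IsProper (σ ≫ q) →
      C.comap jG = vanishingIdeal ⟨Z, hZ⟩ → Flat (C.subschemeι ≫ σ ≫ q) → Scheme.IsRegular C.subscheme →
      IsBlowup τ C → IsLocallyNoetherian X₂ → IsPullback j₂ t₂ ((τ ≫ σ) ≫ q) (Spec.map (CommRingCat.ofHom θ)) → j₂ ≫ τ = υ₂ ≫ jG →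
      𝓕.comap jG = vanishingIdeal ⟨F, hF⟩ → (∀ z : X, (stalkIdeal 𝓕 z).IsPrincipal) → Scheme.IsRegular 𝓕.subscheme →
      σ '' (𝓕.support : Set X) ⊆ {p : P | ¬ IsGenericPoint p Y} →
      (fun _ _ _ _ _ _ _ _ _ σ _ 𝓔 => Flat (𝓔.subschemeι ≫ σ ≫ q)) F₉ Z₉ hZ₉ F₁₀ υ' G γ F X σ jG 𝓕 → ¬ T ⊆ F →
      HasSNCWith [𝓕] C →
      (strictTransformIdeal τ C 𝓕).comap j₂ = vanishingIdeal (⟨closure (υ₂ ⁻¹' (F \ Z)), isClosed_closure⟩ : Closeds G') := by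
    intro C 𝓕 F hF X₂ τ j₂ t₂ hX3 _ hC hCflat _ hτ hX₂ hsq₂ hcomm hF1 _ _ _ _ _ hE
    obtain ⟨hF', hT1, hT2⟩ := hX3
    haveI := hX₂
    exact comap_strictTransformIdeal_eq_vanishingIdeal_of_transversal' hsq hθ hτ hυ₂ hcomm hsq₂ hC hCflat hT1 hT2 hF1 hE
  -- the core
  have hNs'' : ∀ F' ∈ Ns', ∃ F : Set G, (F ∈ Ns ∨ F ∈ H :: (E :: Es)) ∧ F' = closure (υ₂ ⁻¹' (F \ Z)) := by
    intro F' hF'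
    obtain ⟨F, hF, rfl⟩ := hNs' F' hF'
    exact ⟨F, hF.imp id (fun h => List.mem_cons_of_mem _ h), rfl⟩
  have hB := Tower.invB₄_embRoundCore O k θ hθ P q Y hYirr hYcl hPnoeth hPreg Ch hChSplit hChStep _ Z₉ hZ₉ υ' hIso hRuledSt G G' γ T H KH
    (E :: Es) hH Z hZ υ₂ hυ' hZinf hTirr hTH X σ S jG tG hCh hXreg hdom hsq hTS hExcH hCand Ns hNsB hZHT hυ₂ hKHcl hKHE hKHne hC hS hSo hBorn X3
    hSNC hTrace K' E' Es' Ns' hK' hE' hEs'' hNs''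
  have hG'int : IsIntegral G' := hB.2.2.1
  haveI := hG'int
  -- the side facts of `K'`
  rcases hK' with rfl | ⟨-, rfl⟩
  · exact ⟨hB, isClosed_empty, Set.empty_subset _, Set.empty_ne_univ⟩
  · have hne : closure (υ₂ ⁻¹' (KH \ Z)) ≠ Set.univ :=
      closure_preimage_ne_univ υ₂ _ hυ₂ KH Z hKHcl hKHne hZ (fun h => hTZ (h ▸ Set.subset_univ _)) hZsupp.le _
        (Set.preimage_mono fun z hz => hz.1)
    refine ⟨hB, isClosed_closure, ?_, hne⟩
    rcases hE' with rfl | rfl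
    · exact closure_preimage_diff_subset_closure_diff_preimage υ₂ KH Z
    · have h := closure_preimage_diff_subset_of_isBlowup υ₂ (vanishingIdeal (⟨Z, hZ⟩ : Closeds G)) hυ₂ KH H hH hKHE
      rw [hZsupp] at h
      exact h

end Fact

/-! ## The Σ-licence is a lift supplier: WIDTH TABLE D12 is an instance -/

/-- **The Σ-LICENCE IS A LIFT SUPPLIER** for the letter predicate `L := fun G E hE Z hZ => (N1) ∧ (L2) ∧ (L3)` (pure logic: un-bundle the conjunction).
Hence ✓ `Tower.invB₄_secRound_of_licence hSL …` (D12's tower step) is `Tower.invB₄_liftRound_of_supplier (fun G E hE Z hZ => (N1) ∧ (L2) ∧ (L3))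
(Tower.liftSupplier_of_secLicence O k θ hSL) …` fed `⟨hZfin, hL2, hunobs⟩` — desk R77 (c)(ii) «every dealt door is an instance», hosted-round family.
[OURS · pure logic] -/
theorem Tower.liftSupplier_of_secLicence (O : Type) [CommRing O] (k : Type) [Field k] (θ : O →+* k)
    (hSL :
      ∀ {P : Scheme.{0}} (X : Scheme.{0}) (σ : X ⟶ P) (q : P ⟶ Spec (.of O)) (𝓔 : X.IdealSheafData),
        IsIntegral X → IsLocallyNoetherian X → Scheme.IsRegular X → IsProper (σ ≫ q) →
        (∀ x : X, (stalkIdeal 𝓔 x).IsPrincipal) → 𝓔 ≠ ⊥ →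
        Scheme.IsRegular 𝓔.subscheme → Flat (𝓔.subschemeι ≫ σ ≫ q) → IsProper (𝓔.subschemeι ≫ σ ≫ q) →
        ∀ (G : Scheme.{0}) (j : G ⟶ X) (t : G ⟶ Spec (.of k)),
          IsPullback j t (σ ≫ q) (Spec.map (CommRingCat.ofHom θ)) →
          ∀ (E : Set G) (hE : IsClosed E), 𝓔.comap j = vanishingIdeal (⟨E, hE⟩ : Closeds G) →
          ∀ (Z : Set G) (hZ : IsClosed Z), Z ⊆ E →
            Set.Finite {x : ↥(redSub G Z hZ) | ¬ IsRegularLocalRing ((redSub G Z hZ).presheaf.stalk x)} →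
            (∀ z : ↥(redSub G Z hZ), IsClosed ({z} : Set ↥(redSub G Z hZ)) →
              ringKrullDim ((redSub G Z hZ).presheaf.stalk z) = ((1 : ℕ) : WithBot ℕ∞)) →
            (∀ (i : redSub G Z hZ ⟶ redSub G E hE), i ≫ redSubι G E hE = redSubι G Z hZ →
              ∀ z : ↥(redSub G Z hZ), IsClosed ({z} : Set ↥(redSub G Z hZ)) →
                ringKrullDim ((redSub G E hE).presheaf.stalk (i z)) = ((2 : ℕ) : WithBot ℕ∞)) →
            (∀ z ∈ Z, IsClosed ({z} : Set G) → ∃ f : G.presheaf.stalk z,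
              stalkIdeal (vanishingIdeal (⟨Z, hZ⟩ : Closeds G)) z =
                  stalkIdeal (vanishingIdeal (⟨E, hE⟩ : Closeds G)) z ⊔ Ideal.span {f} ∧
                f ∉ stalkIdeal (vanishingIdeal (⟨E, hE⟩ : Closeds G)) z ⊔ (maximalIdeal (G.presheaf.stalk z)) ^ 2) →
            DirStepUnobs G E hE Z hZ →
            ∃ C : X.IdealSheafData, 𝓔 ≤ C ∧ Scheme.IsRegular C.subscheme ∧ Flat (C.subschemeι ≫ σ ≫ q) ∧
              C.comap j = vanishingIdeal (⟨Z, hZ⟩ : Closeds G)) :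
    ∀ {P : Scheme.{0}} (X : Scheme.{0}) (σ : X ⟶ P) (q : P ⟶ Spec (.of O)) (𝓔 : X.IdealSheafData),
      IsIntegral X → IsLocallyNoetherian X → Scheme.IsRegular X → IsProper (σ ≫ q) →
      (∀ x : X, (stalkIdeal 𝓔 x).IsPrincipal) → 𝓔 ≠ ⊥ →
      Scheme.IsRegular 𝓔.subscheme → Flat (𝓔.subschemeι ≫ σ ≫ q) → IsProper (𝓔.subschemeι ≫ σ ≫ q) →
      ∀ (G : Scheme.{0}) (j : G ⟶ X) (t : G ⟶ Spec (.of k)),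
        IsPullback j t (σ ≫ q) (Spec.map (CommRingCat.ofHom θ)) →
        ∀ (E : Set G) (hE : IsClosed E), 𝓔.comap j = vanishingIdeal (⟨E, hE⟩ : Closeds G) →
        ∀ (Z : Set G) (hZ : IsClosed Z), Z ⊆ E →
          (∀ z : ↥(redSub G Z hZ), IsClosed ({z} : Set ↥(redSub G Z hZ)) →
            ringKrullDim ((redSub G Z hZ).presheaf.stalk z) = ((1 : ℕ) : WithBot ℕ∞)) →
          (∀ (i : redSub G Z hZ ⟶ redSub G E hE), i ≫ redSubι G E hE = redSubι G Z hZ →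
            ∀ z : ↥(redSub G Z hZ), IsClosed ({z} : Set ↥(redSub G Z hZ)) →
              ringKrullDim ((redSub G E hE).presheaf.stalk (i z)) = ((2 : ℕ) : WithBot ℕ∞)) →
          (Set.Finite {x : ↥(redSub G Z hZ) | ¬ IsRegularLocalRing ((redSub G Z hZ).presheaf.stalk x)} ∧
            (∀ z ∈ Z, IsClosed ({z} : Set G) → ∃ f : G.presheaf.stalk z,
              stalkIdeal (vanishingIdeal (⟨Z, hZ⟩ : Closeds G)) z =
                  stalkIdeal (vanishingIdeal (⟨E, hE⟩ : Closeds G)) z ⊔ Ideal.span {f} ∧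
                f ∉ stalkIdeal (vanishingIdeal (⟨E, hE⟩ : Closeds G)) z ⊔ (maximalIdeal (G.presheaf.stalk z)) ^ 2) ∧
            DirStepUnobs G E hE Z hZ) →
          ∃ C : X.IdealSheafData, 𝓔 ≤ C ∧ Scheme.IsRegular C.subscheme ∧ Flat (C.subschemeι ≫ σ ≫ q) ∧
            C.comap j = vanishingIdeal (⟨Z, hZ⟩ : Closeds G) := by
  intro P X σ q 𝓔 hX hXn hXr hpr hpri h0 hreg hfl hprE G j t hsq E hE htr Z hZ hZE hZdim hEdim hL
  exact hSL X σ q 𝓔 hX hXn hXr hpr hpri h0 hreg hfl hprE G j t hsq E hE htr Z hZ hZE hL.1 hZdim hEdim hL.2.1 hL.2.2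

end Summit.ResolutionOfSingularities.ResolutionOfSingularities.Cruxes.EquisingularLiftNat.Sections

end
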